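import Summits.CriticalPhenomena.PercolationContinuityZ3.Theorems.PercNearOneGluingNoHeavyLowerTailSunflowerCoverGraded
import Summits.CriticalPhenomena.PercolationContinuityZ3.Theorems.PercNearOneGluingNoHeavyLowerTailSunflowerSafeCalculus
import HarnessLib
import HarnessLib.Audit

/-!
# `NoHeavyLowerTail` (crux stmt-CriticalPhenomena-4575), abstract sunflower cubic: THE CONJECTURE "SAFE ⟹ COVER" AS A TYPED TARGET

Support file (seat `prim-ineq-prove-1` gen 36; `--supports stmt-CriticalPhenomena-4575`).  No `sorry`.  The `@[conjecture]` definition is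
an obligation of this programme (census-true, unproved), never a fact — it is used only as an explicit hypothesis.
Memo: run/shared/lean/prim/prim-ineq-prove-1/FINDING-COVER-prove1-g36.md §7.

`CoverOfSafe`: every SAFE up-set determined by a block (positive probability), with a covering family `𝒯` of bad subsets of the
block, has the COVER PROPERTY `SafeCalc.Cover p a 𝒯` of `…SunflowerCoverGraded`.  KNOWN CASES (theorems of this programme):
`𝒯` with at most three members (`cover_three`, `…SunflowerCoverThree`), log-supermodular hitting functions (memo §4), every read-once
core (`…SunflowerCoverReadOnce`).  EVIDENCE: all multisets of ≤ 4–5 sub-families for the principal filter on four points, `x₁x₂ ∨ x₃x₄`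
and the four non-read-once safe cores of the five-point census (0 violations); the first instance not derivable from safety and Harris
merges is the 5-cycle family `{12,23,34,45,51}` (memo §7).
* `gsafe_of_safe_of_coverOfSafe` — under the conjecture, SAFE ⟹ GRADEDLY SAFE (so the two notions coincide, `safe_of_gsafe`);
* `safe_union_of_coverOfSafe` — under the conjecture, safety is closed under disjunction on disjoint blocks (with `safe_inter` of
  `…SunflowerSafeCalculus`, the safe cores would then form a lattice-closed class).
-/

noncomputable section

namespace Summit.CriticalPhenomena.PercolationContinuityZ3.Theorems.SunflowerPartition

namespace SafeCalc

open MeasureTheory Finset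
open Literature.Probability.LatticeModels Literature.Probability.Percolation

/-- **CONJECTURE (SAFE ⟹ COVER)** (memo §7): for every product measure, every safe up-set `A` determined by a block `a` with
`μ A > 0`, and every family `𝒯` of bad subsets of the block covering all bad missing sets, the cover property `Cover p a 𝒯` holds.
[this work] -/
@[conjecture] def CoverOfSafe : Prop :=
  ∀ (ι : Type) [Fintype ι] [DecidableEq ι] (p : ι → unitInterval) (a : Finset ι) (A : Set (Set ι)) (𝒯 : Finset (Finset ι)),
    DeterminedBy A (↑a : Set ι) → IsUpperSet A → 0 < (prodBernoulli p).real A → (∀ C ∈ 𝒯, C ⊆ a) →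
    (∀ C ∈ 𝒯, ((a \ C : Finset ι) : Set ι) ∉ A) → (∀ T, T ⊆ a → ((a \ T : Finset ι) : Set ι) ∉ A → ∃ C ∈ 𝒯, C ⊆ T) →
    Safe p A → Cover p a 𝒯

variable {ι : Type} [Fintype ι] [DecidableEq ι] (p : ι → unitInterval)

/-- Under `CoverOfSafe`, every safe up-set determined by a block (positive probability, with a covering family of bad sets) is
GRADEDLY safe. [this work] -/
theorem gsafe_of_safe_of_coverOfSafe (hconj : CoverOfSafe) (a : Finset ι) {A : Set (Set ι)} (hd : DeterminedBy A (↑a : Set ι))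
    (hu : IsUpperSet A) (hA : 0 < (prodBernoulli p).real A) (𝒯 : Finset (Finset ι)) (h𝒯a : ∀ C ∈ 𝒯, C ⊆ a)
    (hbad : ∀ C ∈ 𝒯, ((a \ C : Finset ι) : Set ι) ∉ A)
    (hcov : ∀ T, T ⊆ a → ((a \ T : Finset ι) : Set ι) ∉ A → ∃ C ∈ 𝒯, C ⊆ T) (hsafe : Safe p A) : GSafe p a A :=
  gsafe_of_cover p a hd hu hA 𝒯 h𝒯a hbad hcov (hconj ι p a A 𝒯 hd hu hA h𝒯a hbad hcov hsafe)

/-- Under `CoverOfSafe`, safety is closed under DISJUNCTION on disjoint blocks (for a first operand with positive probability and a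
covering family of bad sets). [this work] -/
theorem safe_union_of_coverOfSafe (hconj : CoverOfSafe) (a : Finset ι) {A₁ A₂ : Set (Set ι)}
    (hd₁ : DeterminedBy A₁ (↑a : Set ι)) (hd₂ : DeterminedBy A₂ (↑a : Set ι)ᶜ) (hu₁ : IsUpperSet A₁) (hu₂ : IsUpperSet A₂)
    (hA₁ : 0 < (prodBernoulli p).real A₁) (hA₂ : 0 < (prodBernoulli p).real A₂) (𝒯 : Finset (Finset ι))
    (h𝒯a : ∀ C ∈ 𝒯, C ⊆ a) (hbad : ∀ C ∈ 𝒯, ((a \ C : Finset ι) : Set ι) ∉ A₁)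
    (hcov : ∀ T, T ⊆ a → ((a \ T : Finset ι) : Set ι) ∉ A₁ → ∃ C ∈ 𝒯, C ⊆ T)
    (h₁ : Safe p A₁) (h₂ : Safe p A₂) : Safe p (A₁ ∪ A₂) :=
  safe_union_of_gsafe p a hd₁ hd₂ hu₁ hu₂ hA₂ (gsafe_of_safe_of_coverOfSafe p hconj a hd₁ hu₁ hA₁ 𝒯 h𝒯a hbad hcov h₁) h₂

end SafeCalc

end Summit.CriticalPhenomena.PercolationContinuityZ3.Theorems.SunflowerPartition
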